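import Summits.AtomisticToContinuum.Crystallization.Theorems.GscTwinLoopSurgeryLocalLimitStableField
import Summits.AtomisticToContinuum.Crystallization.Theorems.HullMinimalityLayeredWindowsGroundStatesAreNash
import Literature.Probability.Process.PointStationaryLaw

/-!
# `FrustratedLawDichotomy.TexturedLawTransfer` (stmt-AtomisticToContinuum-27625), line «truncated-bs»:
# the registered stub `stub_nashAtLocalLimits` (S6) — Nash passes to local limits of ground states

Support file for the support item `TexturedLawTransfer` (T) of route
`AtomisticToContinuum/Crystallization/FrustratedLawDichotomy`, skeleton line «truncated-bs»
(`Cruxes/TexturedLawTransfer/Lines/truncated-bs.lean`, composition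
`TexturedLawTransfer_holds_of_stubs`).  It closes the registered stub `stub_nashAtLocalLimits`
(statement below, verbatim the registered signature): a rooted `δ`-hard-core configuration
`μ = count|S` (`IsRootedHardCore δ μ`) which is, at every radius `R` and tolerance `ε > 0`,
two-way `ε`-matched on the ball `‖·‖ ≤ R` by a finite Lennard-Jones ground state `w` recentred at
one of its particles `w j`, is NASH: no atom `p` of `μ` lowers its field energy
`Σ'_{q ≠ p} V_LJ(|p − q|)` by moving to a position `y` avoiding the other atoms.

MECHANISM (Radin 1987 / Bellissard–Radin–Shlosman 2010: stability passes to limits of finite-volume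
ground states; here the one-particle case on the tree's carriers).  Fix the atom `p` and the
competitor `y`.  At scale `(R_j, ε_j) = (j + ‖p‖, 1/(j+1))` let `w^{(j)}` be the matching ground
state, `k_j` THE particle matched to `p` and `T_j` the recentred positions of the OTHER particles
(a `δ₀`-separated finite set, `δ₀ = min(δ, δ_LJ)`, `LennardJonesMinimalDistance_holds`).  Then
`T_j → X' := S ∖ {p}` locally about every centre (the particle matched to an atom `q ≠ p` is not
`k_j`, and the atom matched to a particle `≠ k_j` is not `p`, both by `2ε_j < δ₀`), the matched
particle tends to `p`, and a competitor `y'_j ∉ T_j` with `y'_j → y` exists (a segment is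
infinite).  Finite ground states are Nash (`LayeredWindowsLocal.siteEnergy_le_sum_of_isGroundState`):
`Σ_{q ∈ T_j} V_LJ(|t_j − q|) ≤ Σ_{q ∈ T_j} V_LJ(|y'_j − q|)`, and both sides converge to the
fields of `X'` at `p` and at `y` by the continuity of Lennard-Jones fields under local two-way
matching (`LocalLimitStable.tendsto_sum_lennardJones_of_matched`: uniform `r⁻⁶` tails of separated
configurations + modulus of continuity of `V_LJ` off `0`).  All `[folklore]`.
-/

noncomputable section

open scoped BigOperators Topology
open Filter Set Metric MeasureTheory

namespace Summit.AtomisticToContinuum.Crystallization.Theorems.FrustratedLawDichotomyNashAtLocalLimits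

open Literature.MathematicalPhysics.StatisticalMechanics
open Summit.AtomisticToContinuum.Crystallization.Theorems.LocalLimitStable
  (tendsto_sum_lennardJones_of_matched exists_pos_le_dist_of_not_mem)
open Summit.AtomisticToContinuum.Crystallization.Theorems.LayeredWindowsLocal
  (siteEnergy_le_sum_of_isGroundState)


/-- The atoms of `count|S` are exactly the points of `S`. [folklore] -/
theorem count_restrict_singleton_ne_zero_iff (S : Set (EuclideanSpace ℝ (Fin 3))) (q : EuclideanSpace ℝ (Fin 3)) :
    (Measure.count : Measure (EuclideanSpace ℝ (Fin 3))).restrict S {q} ≠ 0 ↔ q ∈ S := by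
  rw [Measure.restrict_apply (measurableSet_singleton q)]
  by_cases hq : q ∈ S
  · rw [Set.inter_eq_self_of_subset_left (Set.singleton_subset_iff.2 hq), Measure.count_singleton]
    simp [hq]
  · rw [Set.singleton_inter_eq_empty.2 hq, measure_empty]
    simp [hq]

/-- Off any finite set there are points arbitrarily close to a given point `y` (the segment from
`y` in a nonzero direction `e` is infinite). [folklore] -/
theorem exists_near_not_mem_finset (y : EuclideanSpace ℝ (Fin 3)) {e : EuclideanSpace ℝ (Fin 3)} (he : e ≠ 0)
    {r : ℝ} (hr : 0 < r) (T : Finset (EuclideanSpace ℝ (Fin 3))) :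
    ∃ y' : EuclideanSpace ℝ (Fin 3), dist y' y < r ∧ y' ∉ T := by
  have hne : 0 < ‖e‖ := norm_pos_iff.2 he
  have hr' : 0 < r / ‖e‖ := div_pos hr hne
  haveI : Infinite (Set.Ioo (0 : ℝ) (r / ‖e‖)) := Set.Ioo.infinite hr'
  have hinj : Function.Injective fun s : Set.Ioo (0 : ℝ) (r / ‖e‖) => y + (s : ℝ) • e := by
    intro s s' h
    have h1 : (s : ℝ) • e = (s' : ℝ) • e := add_left_cancel h
    exact Subtype.ext (smul_left_injective ℝ he h1)
  obtain ⟨a, ⟨s, rfl⟩, haT⟩ := (Set.infinite_range_of_injective hinj).exists_notMem_finset T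
  refine ⟨_, ?_, haT⟩
  rw [dist_eq_norm, add_sub_cancel_left, norm_smul, Real.norm_eq_abs, abs_of_pos s.2.1]
  exact (lt_div_iff₀ hne).1 s.2.2

/-- **Registered stub `stub_nashAtLocalLimits` (S6) of line «truncated-bs» on
`FrustratedLawDichotomy.TexturedLawTransfer`: Nash passes to local limits of ground states.**
A rooted `δ`-hard-core configuration two-way matched at every radius and tolerance by finite
Lennard-Jones ground states about one of their particles is Nash: for every atom `p` and every
position `y` avoiding the other atoms, `Σ'_{q ≠ p} V_LJ(|p − q|) ≤ Σ'_{q ≠ p} V_LJ(|y − q|)`.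
[folklore] -/
theorem stub_nashAtLocalLimits :
    ∀ δ : ℝ, 0 < δ → ∀ μ : MeasureTheory.Measure (EuclideanSpace ℝ (Fin 3)), Literature.Probability.Process.IsRootedHardCore δ μ → (∀ R ε : ℝ, 0 < ε → ∃ (N : ℕ) (w : Fin N → EuclideanSpace ℝ (Fin 3)) (j : Fin N), Literature.MathematicalPhysics.StatisticalMechanics.IsGroundState Literature.MathematicalPhysics.StatisticalMechanics.lennardJones w ∧ (∀ p : EuclideanSpace ℝ (Fin 3), μ {p} ≠ 0 → ‖p‖ ≤ R → ∃ k : Fin N, dist (w k - w j) p ≤ ε) ∧ (∀ k : Fin N, dist (w k) (w j) ≤ R → ∃ p : EuclideanSpace ℝ (Fin 3), μ {p} ≠ 0 ∧ dist (w k - w j) p ≤ ε)) → ∀ p : EuclideanSpace ℝ (Fin 3), μ {p} ≠ 0 → ∀ y : EuclideanSpace ℝ (Fin 3), (∀ q : EuclideanSpace ℝ (Fin 3), μ {q} ≠ 0 → q ≠ p → y ≠ q) → ∑' q : {q : EuclideanSpace ℝ (Fin 3) // μ {q} ≠ 0 ∧ q ≠ p}, Literature.MathematicalPhysics.StatisticalMechanics.lennardJones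 (dist p (q : EuclideanSpace ℝ (Fin 3))) ≤ ∑' q : {q : EuclideanSpace ℝ (Fin 3) // μ {q} ≠ 0 ∧ q ≠ p}, Literature.MathematicalPhysics.StatisticalMechanics.lennardJones (dist y (q : EuclideanSpace ℝ (Fin 3))) := by
  classical
  intro δ hδ μ hμ hlim p hp y hy
  -- the trivial competitor `y = p`
  by_cases hyp : y = p
  · rw [hyp]
  have hype : y - p ≠ 0 := sub_ne_zero.2 hyp
  obtain ⟨S, h0S, hSsep, rfl⟩ := hμ
  have hat : ∀ q : EuclideanSpace ℝ (Fin 3), (Measure.count : Measure (EuclideanSpace ℝ (Fin 3))).restrict S {q} ≠ 0 ↔ q ∈ S :=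
    count_restrict_singleton_ne_zero_iff S
  have hpS : p ∈ S := (hat p).1 hp
  -- a common separation constant for the atoms and for all Lennard-Jones ground states
  obtain ⟨δ₁, hδ₁, hsep₁⟩ := LennardJonesMinimalDistance_holds
  obtain ⟨δ₀, hδ₀, hδ₀δ, hδ₀δ₁⟩ : ∃ δ₀ : ℝ, 0 < δ₀ ∧ δ₀ ≤ δ ∧ δ₀ ≤ δ₁ :=
    ⟨min δ δ₁, lt_min hδ hδ₁, min_le_left _ _, min_le_right _ _⟩
  -- the matching ground states at scale `(j + ‖p‖, 1/(j+1))` and the particle matched to `p`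
  choose N w i hGS hA hB using fun j : ℕ =>
    hlim ((j : ℝ) + ‖p‖) (1 / ((j : ℝ) + 1)) (by positivity)
  choose kp hkp using fun j : ℕ => hA j p hp (by linarith [(Nat.cast_nonneg j : (0 : ℝ) ≤ j)])
  -- the recentred positions of the other particles
  obtain ⟨T, hT⟩ : ∃ T : ℕ → Finset (EuclideanSpace ℝ (Fin 3)),
      ∀ j, T j = (Finset.univ.erase (kp j)).image (fun k => w j k - w j (i j)) := ⟨_, fun _ => rfl⟩
  have hmemT : ∀ j (a : EuclideanSpace ℝ (Fin 3)), a ∈ T j ↔ ∃ k : Fin (N j), k ≠ kp j ∧ w j k - w j (i j) = a := by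
    intro j a
    rw [hT j, Finset.mem_image]
    constructor
    · rintro ⟨k, hk, hka⟩
      exact ⟨k, (Finset.mem_erase.1 hk).1, hka⟩
    · rintro ⟨k, hk, hka⟩
      exact ⟨k, Finset.mem_erase.2 ⟨hk, Finset.mem_univ k⟩, hka⟩
  have hdsub : ∀ j (a b : Fin (N j)),
      dist (w j a - w j (i j)) (w j b - w j (i j)) = dist (w j a) (w j b) := fun j a b => by
    rw [dist_eq_norm, dist_eq_norm, sub_sub_sub_cancel_right]
  have hTsep : ∀ j, ∀ a ∈ T j, ∀ b ∈ T j, a ≠ b → δ₀ ≤ dist a b := by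
    intro j a ha b hb hab
    obtain ⟨k, -, rfl⟩ := (hmemT j a).1 ha
    obtain ⟨l, -, rfl⟩ := (hmemT j b).1 hb
    have hkl : k ≠ l := fun h => hab (by rw [h])
    rw [hdsub]
    exact hδ₀δ₁.trans (hsep₁ (N j) (w j) (hGS j) k l hkl)
  -- the limit configuration without the atom `p`
  obtain ⟨X', hX'⟩ : ∃ X' : Set (EuclideanSpace ℝ (Fin 3)),
      X' = {q | (Measure.count : Measure (EuclideanSpace ℝ (Fin 3))).restrict S {q} ≠ 0 ∧ q ≠ p} := ⟨_, rfl⟩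
  have hmemX' : ∀ q, q ∈ X' ↔ q ∈ S ∧ q ≠ p := fun q => by
    rw [hX', Set.mem_setOf_eq, hat]
  have hX'sep : ∀ a ∈ X', ∀ b ∈ X', a ≠ b → δ₀ ≤ dist a b := fun a ha b hb hab =>
    hδ₀δ.trans (hSsep a ((hmemX' a).1 ha).1 b ((hmemX' b).1 hb).1 hab)
  have hpX' : p ∉ X' := fun h => ((hmemX' p).1 h).2 rfl
  have hyX' : y ∉ X' := fun h =>
    hy y ((hat y).2 ((hmemX' y).1 h).1) ((hmemX' y).1 h).2 rfl
  -- `T_j → X'` locally about every centre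
  have hmatch : ∀ c : EuclideanSpace ℝ (Fin 3), ∀ R ε : ℝ, 0 < ε → ∀ᶠ j : ℕ in atTop,
      (∀ q ∈ X', dist q c ≤ R → ∃ q' ∈ T j, dist q' q ≤ ε) ∧
        (∀ q' ∈ T j, dist q' c ≤ R → ∃ q ∈ X', dist q' q ≤ ε) := by
    intro c R ε hε
    have hev1 : ∀ᶠ j : ℕ in atTop, 1 / ((j : ℝ) + 1) < min ε (δ₀ / 2) :=
      (tendsto_one_div_add_atTop_nhds_zero_nat (𝕜 := ℝ)).eventually
        (gt_mem_nhds (lt_min hε (half_pos hδ₀)))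
    have hev2 : ∀ᶠ j : ℕ in atTop, R + ‖c‖ ≤ (j : ℝ) := by
      filter_upwards [Filter.eventually_ge_atTop ⌈R + ‖c‖⌉₊] with j hj
      exact (Nat.le_ceil _).trans (by exact_mod_cast hj)
    filter_upwards [hev1, hev2] with j hj1 hj2
    have hjε : 1 / ((j : ℝ) + 1) ≤ ε := (hj1.trans_le (min_le_left _ _)).le
    have hjδ : 2 * (1 / ((j : ℝ) + 1)) < δ₀ := by
      have := hj1.trans_le (min_le_right _ _)
      linarith
    refine ⟨fun q hq hqc => ?_, fun q' hq' hq'c => ?_⟩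
    · obtain ⟨hqS, hqp⟩ := (hmemX' q).1 hq
      have hqn : ‖q‖ ≤ (j : ℝ) + ‖p‖ := by
        have h1 := dist_triangle q c 0
        simp only [dist_zero_right] at h1
        linarith [norm_nonneg p]
      obtain ⟨k, hk⟩ := hA j q ((hat q).2 hqS) hqn
      have hkne : k ≠ kp j := by
        rintro rfl
        have h2 : dist q p ≤ 2 * (1 / ((j : ℝ) + 1)) :=
          calc dist q p ≤ dist (w j (kp j) - w j (i j)) q + dist (w j (kp j) - w j (i j)) p :=
                dist_triangle_left _ _ _
            _ ≤ 1 / ((j : ℝ) + 1) + 1 / ((j : ℝ) + 1) := add_le_add hk (hkp j)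
            _ = 2 * (1 / ((j : ℝ) + 1)) := by ring
        have h3 := hSsep q hqS p hpS hqp
        linarith
      exact ⟨w j k - w j (i j), (hmemT j _).2 ⟨k, hkne, rfl⟩, hk.trans hjε⟩
    · obtain ⟨k, hkne, rfl⟩ := (hmemT j q').1 hq'
      have hkn : dist (w j k) (w j (i j)) ≤ (j : ℝ) + ‖p‖ := by
        have h1 := dist_triangle (w j k - w j (i j)) c 0
        simp only [dist_zero_right] at h1
        rw [← dist_eq_norm] at h1
        linarith [norm_nonneg p]
      obtain ⟨q, hq, hkq⟩ := hB j k hkn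
      have hqS : q ∈ S := (hat q).1 hq
      have hqp : q ≠ p := by
        intro hqp
        rw [hqp] at hkq
        have h2 : dist (w j k) (w j (kp j)) ≤ 2 * (1 / ((j : ℝ) + 1)) :=
          calc dist (w j k) (w j (kp j))
                = dist (w j k - w j (i j)) (w j (kp j) - w j (i j)) := (hdsub j _ _).symm
            _ ≤ dist (w j k - w j (i j)) p + dist (w j (kp j) - w j (i j)) p :=
                dist_triangle_right _ _ _
            _ ≤ 1 / ((j : ℝ) + 1) + 1 / ((j : ℝ) + 1) := add_le_add hkq (hkp j)
            _ = 2 * (1 / ((j : ℝ) + 1)) := by ring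
        have h3 := hsep₁ (N j) (w j) (hGS j) k (kp j) hkne
        linarith
      exact ⟨q, (hmemX' q).2 ⟨hqS, hqp⟩, hkq.trans hjε⟩
  -- (a) the site energy of the matched particle converges to the field of `X'` at `p`
  obtain ⟨ρp, hρp, hρpX⟩ := exists_pos_le_dist_of_not_mem hδ₀ hX'sep hpX'
  have hwt : Tendsto (fun j => w j (kp j) - w j (i j)) atTop (𝓝 p) := by
    rw [tendsto_iff_dist_tendsto_zero]
    exact squeeze_zero (fun j => dist_nonneg) (fun j => hkp j)
      (tendsto_one_div_add_atTop_nhds_zero_nat (𝕜 := ℝ))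
  have hlimA := tendsto_sum_lennardJones_of_matched hδ₀ hX'sep hρp hρpX hTsep hwt (hmatch p)
  -- (b) a competitor `y'_j ∉ T_j`, `y'_j → y`, and the field of `T_j` at `y'_j`
  choose y' hy'd hy'T using fun j : ℕ =>
    exists_near_not_mem_finset y hype (show (0 : ℝ) < 1 / ((j : ℝ) + 1) by positivity) (T j)
  obtain ⟨ρy, hρy, hρyX⟩ := exists_pos_le_dist_of_not_mem hδ₀ hX'sep hyX'
  have hwy : Tendsto y' atTop (𝓝 y) := by
    rw [tendsto_iff_dist_tendsto_zero]
    exact squeeze_zero (fun j => dist_nonneg) (fun j => (hy'd j).le)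
      (tendsto_one_div_add_atTop_nhds_zero_nat (𝕜 := ℝ))
  have hlimB := tendsto_sum_lennardJones_of_matched hδ₀ hX'sep hρy hρyX hTsep hwy (hmatch y)
  -- (c) finite ground states are Nash, at every stage
  have hab : ∀ j : ℕ, ∑ q ∈ T j, lennardJones (dist (w j (kp j) - w j (i j)) q) ≤
      ∑ q ∈ T j, lennardJones (dist (y' j) q) := by
    intro j
    have hinj : ∀ a ∈ Finset.univ.erase (kp j), ∀ b ∈ Finset.univ.erase (kp j),
        w j a - w j (i j) = w j b - w j (i j) → a = b := fun a _ b _ h =>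
      (hGS j).1 (sub_left_injective h)
    have hne : ∀ k : Fin (N j), k ≠ kp j → y' j + w j (i j) ≠ w j k := by
      intro k hk h
      refine hy'T j ((hmemT j _).2 ⟨k, hk, ?_⟩)
      rw [← h, add_sub_cancel_right]
    have hN := siteEnergy_le_sum_of_isGroundState (hGS j) (kp j) hne
    unfold siteEnergy at hN
    have e2 : ∀ k : Fin (N j), dist (y' j) (w j k - w j (i j)) = dist (y' j + w j (i j)) (w j k) := by
      intro k
      rw [dist_eq_norm, dist_eq_norm]
      congr 1
      abel
    rw [hT j, Finset.sum_image hinj, Finset.sum_image hinj]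
    simp only [hdsub, e2]
    exact hN
  -- (d) pass to the limit
  have hAB := le_of_tendsto_of_tendsto' hlimA hlimB hab
  rw [hX'] at hAB
  exact hAB

end Summit.AtomisticToContinuum.Crystallization.Theorems.FrustratedLawDichotomyNashAtLocalLimits

end
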